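import Mathlib.NumberTheory.NumberField.Cyclotomic.Basic
import HarnessLib

/-!
# Weil-type family coverage — `(1 − η)^{φ(q)} = p·(explicit unit)` for a primitive `q`-th root of unity `η`,
# `q ∈ {3, 4, 7, 9, 11}`: the ideal `(1 − η)` of `𝓞 K` has `(1 − η)^{φ(q)} = (p)` (the prime elements behind part 49's
# ramified polarisation types)

research route conditional on HC_CM; not a corollary; Q11.4-sentence-2 already refuted in dim ≥ 3.

Ring 2, WEIL-TYPE FAMILY-COVERAGE CENSUS (`HOME/WEIL-FAMILY-COVERAGE.md` `## b01`, blocks b01.17 / b01.34–b01.38; owner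
ring2-b01), part 48c of the `Ring2WeilCoverage*` series.  Part 48 (`…RamifiedTypes`) polarises the principal CM torus
`ℂ^Φ/Φ(ℤ[ζ_M])` by Shimura's divisors of type `𝔣₀` with `𝔬𝔣₀ = (π)`, `π = ζ^h(1 − ζ^a)(1 − ζ^b)`, where `η = ζ^a` is a
primitive `q`-th root of unity for a prime power `q = p^k ∣ M` — so `(π) = (1 − η)` up to the unit factors `ζ^h`,
`1 − ζ^b`.  This file pins down that ideal for the five prime powers met at the census's NO levels
(`q = 3` at `M = 21`; `q = 7` at `28, 35`; `q = 9` at `36, 45`; `q = 4` at `36, 44`; `q = 11` at `33, 44`): for any number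
field `K` and `η ∈ K` a primitive `q`-th root of unity,

* `one_sub_pow_eq_q`: **`(1 − η)^{φ(q)} = p · W_q(η)`** with `W_q ∈ ℤ[η]` explicit (`W₃ = W₄ = −η`,
  `W₇ = −η + 2η² − 3η³ + 2η⁴ − η⁵`, `W₉ = −2η + 5η² − 7η³ + 5η⁴ − 2η⁵`,
  `W₁₁ = −η + 4η² − 11η³ + 19η⁴ − 23η⁵ + 19η⁶ − 11η⁷ + 4η⁸ − η⁹`) — in each case `(1 − x)^{φ(q)} − p·W_q(x) = Φ_q(x)`
  identically;
* `isUnit_W_q`: `W_q(η)` is a unit of `𝓞 K` (explicit inverse in `ℤ[η]`, certificate modulo `Φ_q`);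
* **`span_one_sub_pow_eq_q`: `(1 − η)^{φ(q)}·𝓞 K = p·𝓞 K`** as ideals of `𝓞 K` — so a type `𝔣₀` with
  `𝔬𝔣₀ = (1 − η)·(unit)` has `(𝔬𝔣₀)^{φ(q)} = (p)^{?}`… precisely `(𝔬𝔣₀)^{φ(q)} = p𝔬`, i.e. `N(𝔬𝔣₀) = p^{[K:ℚ]/φ(q)}` and the
  polarisation of type `𝔣₀` on a `g`-dimensional CM torus has degree `p^{g/φ(q)}` (census b01.17's types `(1,1,1,3,3,3)` at
  `M = 21`, `(1⁵,3)` / `(1,1,1,2,2,2)` at `36`, `(1⁵,7)` at `28`, …).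

Certificates: `work/py/primepow.py` (exact arithmetic in `ℤ[x]/(Φ_q)`); every identity is re-verified here by
`linear_combination` from the single relation `Φ_q(η) = 0` (Mathlib `IsPrimitiveRoot.geom_sum_eq_zero`, resp. `η² = −1`,
`1 + η³ + η⁶ = 0`).

HONEST FRAMING: elementary identities in `ℤ[η]` and the ideals they give in `𝓞 K`; nothing here mentions Hodge classes,
polarisations, `W_K` or HC; `HC_CM` is used nowhere.  No `def`, no named fact, no `sorry`.

References: [cite: Washington1997, Lemma 1.4 and Prop. 2.8]; census b01.17 (seat-derived).
-/

noncomputable section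

open NumberField

namespace Summit.HodgeConjecture.Ring2WeilCoverage.RamifiedPrimePowers

variable {K : Type} [Field K] {η : K}

/-! ### `q = 3` -/

/-- `1 + η + η² = 0` for a primitive cube root of unity. [folklore] -/
theorem rel_three (hη : IsPrimitiveRoot η 3) : 1 + η + η ^ 2 = 0 := by
  have h := hη.geom_sum_eq_zero (by norm_num)
  simpa [Finset.sum_range_succ] using h

/-- **`(1 − η)² = 3·(−η)`** for a primitive cube root of unity `η`.
research route conditional on HC_CM; not a corollary; Q11.4-sentence-2 already refuted in dim ≥ 3. [cite: Washington1997, Lemma 1.4] -/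
theorem one_sub_pow_eq_three (hη : IsPrimitiveRoot η 3) : (1 - η) ^ 2 = 3 * (-η) := by
  linear_combination rel_three hη

/-- `W₃ = −η` is a unit of `𝓞 K` (inverse `1 + η`). [folklore] -/
theorem isUnit_W_three (hη : IsPrimitiveRoot η 3) : IsUnit (-hη.toInteger : 𝓞 K) := by
  have hzK : algebraMap (𝓞 K) K hη.toInteger = η := rfl
  refine IsUnit.of_mul_eq_one (1 + hη.toInteger) (RingOfIntegers.ext ?_)
  push_cast; simp only [hzK]
  linear_combination (-1 : K) * rel_three hη

/-- **`(1 − η)²·𝓞 K = 3·𝓞 K`** for a primitive cube root of unity `η ∈ K`.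
research route conditional on HC_CM; not a corollary; Q11.4-sentence-2 already refuted in dim ≥ 3. [cite: Washington1997, Lemma 1.4] -/
theorem span_one_sub_pow_eq_three (hη : IsPrimitiveRoot η 3) :
    Ideal.span {(1 - hη.toInteger : 𝓞 K)} ^ 2 = Ideal.span {(3 : 𝓞 K)} := by
  have hzK : algebraMap (𝓞 K) K hη.toInteger = η := rfl
  have h : (1 - hη.toInteger : 𝓞 K) ^ 2 = 3 * (-hη.toInteger) := RingOfIntegers.ext (by
    push_cast; simp only [hzK, map_ofNat]; exact one_sub_pow_eq_three hη)
  rw [Ideal.span_singleton_pow, h, Ideal.span_singleton_mul_right_unit (isUnit_W_three hη)]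

/-! ### `q = 4` -/

/-- `η² = −1` for a primitive fourth root of unity. [folklore] -/
theorem rel_four (hη : IsPrimitiveRoot η 4) : η ^ 2 = -1 := by
  have h4 : (η ^ 2) ^ 2 = 1 := by rw [← pow_mul]; exact hη.pow_eq_one
  have h2 : η ^ 2 ≠ 1 := hη.pow_ne_one_of_pos_of_lt (by norm_num) (by norm_num)
  have : (η ^ 2 - 1) * (η ^ 2 + 1) = 0 := by linear_combination h4
  rcases mul_eq_zero.mp this with h | h
  · exact absurd (sub_eq_zero.mp h) h2
  · linear_combination h

/-- **`(1 − η)² = 2·(−η)`** for a primitive fourth root of unity `η` (`(1 − i)² = −2i`).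
research route conditional on HC_CM; not a corollary; Q11.4-sentence-2 already refuted in dim ≥ 3. [cite: Washington1997, Lemma 1.4] -/
theorem one_sub_pow_eq_four (hη : IsPrimitiveRoot η 4) : (1 - η) ^ 2 = 2 * (-η) := by
  linear_combination rel_four hη

/-- `W₄ = −η` is a unit of `𝓞 K` (inverse `η`). [folklore] -/
theorem isUnit_W_four (hη : IsPrimitiveRoot η 4) : IsUnit (-hη.toInteger : 𝓞 K) := by
  have hzK : algebraMap (𝓞 K) K hη.toInteger = η := rfl
  refine IsUnit.of_mul_eq_one hη.toInteger (RingOfIntegers.ext ?_)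
  push_cast; simp only [hzK]
  linear_combination (-1 : K) * rel_four hη

/-- **`(1 − η)²·𝓞 K = 2·𝓞 K`** for a primitive fourth root of unity `η ∈ K`.
research route conditional on HC_CM; not a corollary; Q11.4-sentence-2 already refuted in dim ≥ 3. [cite: Washington1997, Lemma 1.4] -/
theorem span_one_sub_pow_eq_four (hη : IsPrimitiveRoot η 4) :
    Ideal.span {(1 - hη.toInteger : 𝓞 K)} ^ 2 = Ideal.span {(2 : 𝓞 K)} := by
  have hzK : algebraMap (𝓞 K) K hη.toInteger = η := rfl
  have h : (1 - hη.toInteger : 𝓞 K) ^ 2 = 2 * (-hη.toInteger) := RingOfIntegers.ext (by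
    push_cast; simp only [hzK, map_ofNat]; exact one_sub_pow_eq_four hη)
  rw [Ideal.span_singleton_pow, h, Ideal.span_singleton_mul_right_unit (isUnit_W_four hη)]

/-! ### `q = 7` -/

/-- `Φ₇(η) = 0` for a primitive seventh root of unity. [folklore] -/
theorem rel_seven (hη : IsPrimitiveRoot η 7) : 1 + η + η ^ 2 + η ^ 3 + η ^ 4 + η ^ 5 + η ^ 6 = 0 := by
  have h := hη.geom_sum_eq_zero (by norm_num)
  simpa [Finset.sum_range_succ] using h

/-- **`(1 − η)⁶ = 7·W₇(η)`**, `W₇ = −η + 2η² − 3η³ + 2η⁴ − η⁵`, for a primitive seventh root of unity `η`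
(`(1 − x)⁶ − 7W₇(x) = Φ₇(x)`).
research route conditional on HC_CM; not a corollary; Q11.4-sentence-2 already refuted in dim ≥ 3. [cite: Washington1997, Lemma 1.4] -/
theorem one_sub_pow_eq_seven (hη : IsPrimitiveRoot η 7) :
    (1 - η) ^ 6 = 7 * (-η + 2 * η ^ 2 - 3 * η ^ 3 + 2 * η ^ 4 - η ^ 5) := by
  linear_combination rel_seven hη

/-- `W₇(η)` is a unit of `𝓞 K` (inverse `3 + 3η − 4η³ − 6η⁴ − 4η⁵`). [folklore] -/
theorem isUnit_W_seven (hη : IsPrimitiveRoot η 7) :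
    IsUnit (-hη.toInteger + 2 * hη.toInteger ^ 2 - 3 * hη.toInteger ^ 3 + 2 * hη.toInteger ^ 4 -
      hη.toInteger ^ 5 : 𝓞 K) := by
  have hzK : algebraMap (𝓞 K) K hη.toInteger = η := rfl
  refine IsUnit.of_mul_eq_one
    (3 + 3 * hη.toInteger - 4 * hη.toInteger ^ 3 - 6 * hη.toInteger ^ 4 - 4 * hη.toInteger ^ 5) (RingOfIntegers.ext ?_)
  push_cast; simp only [hzK, map_ofNat]
  linear_combination (-1 - 2 * η + 6 * η ^ 2 - 6 * η ^ 3 + 4 * η ^ 4) * rel_seven hη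

/-- **`(1 − η)⁶·𝓞 K = 7·𝓞 K`** for a primitive seventh root of unity `η ∈ K`.
research route conditional on HC_CM; not a corollary; Q11.4-sentence-2 already refuted in dim ≥ 3. [cite: Washington1997, Lemma 1.4] -/
theorem span_one_sub_pow_eq_seven (hη : IsPrimitiveRoot η 7) :
    Ideal.span {(1 - hη.toInteger : 𝓞 K)} ^ 6 = Ideal.span {(7 : 𝓞 K)} := by
  have hzK : algebraMap (𝓞 K) K hη.toInteger = η := rfl
  have h : (1 - hη.toInteger : 𝓞 K) ^ 6 =
      7 * (-hη.toInteger + 2 * hη.toInteger ^ 2 - 3 * hη.toInteger ^ 3 + 2 * hη.toInteger ^ 4 - hη.toInteger ^ 5) :=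
    RingOfIntegers.ext (by push_cast; simp only [hzK, map_ofNat]; exact one_sub_pow_eq_seven hη)
  rw [Ideal.span_singleton_pow, h, Ideal.span_singleton_mul_right_unit (isUnit_W_seven hη)]

/-! ### `q = 9` -/

/-- `Φ₉(η) = 1 + η³ + η⁶ = 0` for a primitive ninth root of unity (`η³` is a primitive cube root). [folklore] -/
theorem rel_nine (hη : IsPrimitiveRoot η 9) : 1 + η ^ 3 + η ^ 6 = 0 := by
  have h3 : IsPrimitiveRoot (η ^ 3) 3 := hη.pow (by norm_num) (by norm_num)
  have h := rel_three h3
  linear_combination h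

/-- **`(1 − η)⁶ = 3·W₉(η)`**, `W₉ = −2η + 5η² − 7η³ + 5η⁴ − 2η⁵`, for a primitive ninth root of unity `η`
(`(1 − x)⁶ − 3W₉(x) = Φ₉(x)`).
research route conditional on HC_CM; not a corollary; Q11.4-sentence-2 already refuted in dim ≥ 3. [cite: Washington1997, Lemma 1.4] -/
theorem one_sub_pow_eq_nine (hη : IsPrimitiveRoot η 9) :
    (1 - η) ^ 6 = 3 * (-2 * η + 5 * η ^ 2 - 7 * η ^ 3 + 5 * η ^ 4 - 2 * η ^ 5) := by
  linear_combination rel_nine hη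

/-- `W₉(η)` is a unit of `𝓞 K` (inverse `10 + 11η + 7η² + 10η³ + 4η⁴ − 4η⁵`). [folklore] -/
theorem isUnit_W_nine (hη : IsPrimitiveRoot η 9) :
    IsUnit (-2 * hη.toInteger + 5 * hη.toInteger ^ 2 - 7 * hη.toInteger ^ 3 + 5 * hη.toInteger ^ 4 -
      2 * hη.toInteger ^ 5 : 𝓞 K) := by
  have hzK : algebraMap (𝓞 K) K hη.toInteger = η := rfl
  refine IsUnit.of_mul_eq_one
    (10 + 11 * hη.toInteger + 7 * hη.toInteger ^ 2 + 10 * hη.toInteger ^ 3 + 4 * hη.toInteger ^ 4 -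
      4 * hη.toInteger ^ 5) (RingOfIntegers.ext ?_)
  push_cast; simp only [hzK, map_ofNat]
  linear_combination (-1 - 20 * η + 28 * η ^ 2 - 28 * η ^ 3 + 8 * η ^ 4) * rel_nine hη

/-- **`(1 − η)⁶·𝓞 K = 3·𝓞 K`** for a primitive ninth root of unity `η ∈ K`.
research route conditional on HC_CM; not a corollary; Q11.4-sentence-2 already refuted in dim ≥ 3. [cite: Washington1997, Lemma 1.4] -/
theorem span_one_sub_pow_eq_nine (hη : IsPrimitiveRoot η 9) :
    Ideal.span {(1 - hη.toInteger : 𝓞 K)} ^ 6 = Ideal.span {(3 : 𝓞 K)} := by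
  have hzK : algebraMap (𝓞 K) K hη.toInteger = η := rfl
  have h : (1 - hη.toInteger : 𝓞 K) ^ 6 =
      3 * (-2 * hη.toInteger + 5 * hη.toInteger ^ 2 - 7 * hη.toInteger ^ 3 + 5 * hη.toInteger ^ 4 -
        2 * hη.toInteger ^ 5) :=
    RingOfIntegers.ext (by push_cast; simp only [hzK, map_ofNat]; exact one_sub_pow_eq_nine hη)
  rw [Ideal.span_singleton_pow, h, Ideal.span_singleton_mul_right_unit (isUnit_W_nine hη)]

/-! ### `q = 11` -/

/-- `Φ₁₁(η) = 0` for a primitive eleventh root of unity. [folklore] -/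
theorem rel_eleven (hη : IsPrimitiveRoot η 11) :
    1 + η + η ^ 2 + η ^ 3 + η ^ 4 + η ^ 5 + η ^ 6 + η ^ 7 + η ^ 8 + η ^ 9 + η ^ 10 = 0 := by
  have h := hη.geom_sum_eq_zero (by norm_num)
  simpa [Finset.sum_range_succ] using h

/-- **`(1 − η)¹⁰ = 11·W₁₁(η)`**, `W₁₁ = −η + 4η² − 11η³ + 19η⁴ − 23η⁵ + 19η⁶ − 11η⁷ + 4η⁸ − η⁹`, for a primitive
eleventh root of unity `η` (`(1 − x)¹⁰ − 11W₁₁(x) = Φ₁₁(x)`).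
research route conditional on HC_CM; not a corollary; Q11.4-sentence-2 already refuted in dim ≥ 3. [cite: Washington1997, Lemma 1.4] -/
theorem one_sub_pow_eq_eleven (hη : IsPrimitiveRoot η 11) :
    (1 - η) ^ 10 = 11 * (-η + 4 * η ^ 2 - 11 * η ^ 3 + 19 * η ^ 4 - 23 * η ^ 5 + 19 * η ^ 6 - 11 * η ^ 7 +
      4 * η ^ 8 - η ^ 9) := by
  linear_combination rel_eleven hη

/-- `W₁₁(η)` is a unit of `𝓞 K` (explicit inverse of height `1027`). [folklore] -/
theorem isUnit_W_eleven (hη : IsPrimitiveRoot η 11) :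
    IsUnit (-hη.toInteger + 4 * hη.toInteger ^ 2 - 11 * hη.toInteger ^ 3 + 19 * hη.toInteger ^ 4 -
      23 * hη.toInteger ^ 5 + 19 * hη.toInteger ^ 6 - 11 * hη.toInteger ^ 7 + 4 * hη.toInteger ^ 8 -
      hη.toInteger ^ 9 : 𝓞 K) := by
  have hzK : algebraMap (𝓞 K) K hη.toInteger = η := rfl
  refine IsUnit.of_mul_eq_one
    (188 + 188 * hη.toInteger - 317 * hη.toInteger ^ 3 - 663 * hη.toInteger ^ 4 - 928 * hη.toInteger ^ 5 -
      1027 * hη.toInteger ^ 6 - 928 * hη.toInteger ^ 7 - 663 * hη.toInteger ^ 8 - 317 * hη.toInteger ^ 9)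
    (RingOfIntegers.ext ?_)
  push_cast; simp only [hzK, map_ofNat]
  linear_combination (-1 - 187 * η + 752 * η ^ 2 - 1880 * η ^ 3 + 3137 * η ^ 4 - 3178 * η ^ 5 + 2368 * η ^ 6 -
    922 * η ^ 7 + 317 * η ^ 8) * rel_eleven hη

/-- **`(1 − η)¹⁰·𝓞 K = 11·𝓞 K`** for a primitive eleventh root of unity `η ∈ K`.
research route conditional on HC_CM; not a corollary; Q11.4-sentence-2 already refuted in dim ≥ 3. [cite: Washington1997, Lemma 1.4] -/
theorem span_one_sub_pow_eq_eleven (hη : IsPrimitiveRoot η 11) :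
    Ideal.span {(1 - hη.toInteger : 𝓞 K)} ^ 10 = Ideal.span {(11 : 𝓞 K)} := by
  have hzK : algebraMap (𝓞 K) K hη.toInteger = η := rfl
  have h : (1 - hη.toInteger : 𝓞 K) ^ 10 =
      11 * (-hη.toInteger + 4 * hη.toInteger ^ 2 - 11 * hη.toInteger ^ 3 + 19 * hη.toInteger ^ 4 -
        23 * hη.toInteger ^ 5 + 19 * hη.toInteger ^ 6 - 11 * hη.toInteger ^ 7 + 4 * hη.toInteger ^ 8 -
        hη.toInteger ^ 9) :=
    RingOfIntegers.ext (by push_cast; simp only [hzK, map_ofNat]; exact one_sub_pow_eq_eleven hη)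
  rw [Ideal.span_singleton_pow, h, Ideal.span_singleton_mul_right_unit (isUnit_W_eleven hη)]

end Summit.HodgeConjecture.Ring2WeilCoverage.RamifiedPrimePowers

end
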